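import Summits.KontsevichZagierPeriods.KontsevichZagierPeriods.Theorems.RootDecompQuadraticDescentEisensteinPairP1

/-!
# Census pair #22 (the ℚ(√−3) pair 4·[□²,1/(3−2N)] ≡ 5·[□²,1/(3−N)], N = u²−uv+v²) and #0 DECIDED in `KZ.relations` by rules 1+2 (route `RootDecompQuadraticDescent`, instances of crux stmt-KontsevichZagierPeriods-28994 / stmt-4280) · part 2/7

Cell `decomp-kz`, lens 6 (decomp-kz-lens-6 g7): `pair22 : 4•[□²,1/(1+2x+2y−2x²+2xy−2y²)] − 5•[□²,1/(2+x+y−x²+xy−y²)] ∈ KZ.relations` (values (5/8)·L(2,χ₋₃), L(2,χ₋₃)/2): reflections → diagonal cut + fold → BLOW-UP (u,k) ↦ (u,uk) via `KZ.of_sub_of_mem_relations_of_affine` → fibre substitution into a LOG BAND over q(u) = 1−u+u² → 23 band relations incl. SEVEN ℚ-rational base substitutions (dihedral symmetries + angle doublings of the Eisenstein conic) + one ℤ-identity; NO Stokes; `pair0` by ONE Möbius substitution y = x/(2−x); packaged `pairs_decided`, `pairs_descentTwoQ_instances`, `pairs_of_kzDimTwo` BY NAME.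

Source: `HOME/decomp-kz-lens-6/g7/EisensteinPair22.lean` sha256 fdb5e0bbc5a4a341 (1894 l; critic decomp-kz-crit-1 g2 CLEARED 2026-08-30T07:59:44Z, std axioms), split into 7 modules by the landing seat decomp-kz-census-1 g7 (contexts re-opened per part; generic docstrings added where the source had none; the route file is imported only by the last part, which proves the `KZDimTwo` corollaries BY NAME).  No `sorry`; standard axioms.  References: [cite: KontsevichZagier2001, §1.2].
-/

noncomputable section

open MeasureTheory Set MvPolynomial

namespace Summit.KontsevichZagierPeriods.RootDecompQuadraticDescent.EisensteinPair

open Literature.NumberTheory.Transcendental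
open Literature.NumberTheory.Transcendental.KZ
open Literature.ModelTheory.ExponentialFields (IsSemialgebraic)

-- PRIVATE copy (landed twin lives in a farm-unbuilt module; dedup.landed): snoc2_zero, snoc2_one, init2_zero
/-- `snoc2_zero`: auxiliary theorem of the lens-6 development «eis» (instances of 28994/4280) — see the module docstring; verbatim from the lens file. -/
@[simp] private theorem snoc2_zero (x : Fin 1 → ℝ) (t : ℝ) : (Fin.snoc x t : Fin 2 → ℝ) 0 = x 0 := rfl

/-- `snoc2_one`: auxiliary theorem of the lens-6 development «eis» (instances of 28994/4280) — see the module docstring; verbatim from the lens file. -/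
@[simp] private theorem snoc2_one (x : Fin 1 → ℝ) (t : ℝ) : (Fin.snoc x t : Fin 2 → ℝ) 1 = t := rfl

/-- `init2_zero`: auxiliary theorem of the lens-6 development «eis» (instances of 28994/4280) — see the module docstring; verbatim from the lens file. -/
@[simp] private theorem init2_zero (z : Fin 2 → ℝ) : Fin.init z 0 = z 0 := rfl

/-- `hasDerivAt_moebius`: auxiliary theorem of the lens-6 development «eis» (instances of 28994/4280) — see the module docstring; verbatim from the lens file. -/
theorem hasDerivAt_moebius (α β γ δ t : ℝ) (h : γ * t + δ ≠ 0) :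
    HasDerivAt (fun t => (α * t + β) / (γ * t + δ))
      ((α * (γ * t + δ) - (α * t + β) * γ) / (γ * t + δ) ^ 2) t := by
  have h1 : HasDerivAt (fun t => α * t + β) α t := by
    simpa using ((hasDerivAt_id' t).const_mul α).add_const β
  have h2 : HasDerivAt (fun t => γ * t + δ) γ t := by
    simpa using ((hasDerivAt_id' t).const_mul γ).add_const δ
  exact h1.div h2 h

/-- `hasDerivAt_quad`: auxiliary theorem of the lens-6 development «eis» (instances of 28994/4280) — see the module docstring; verbatim from the lens file. -/
theorem hasDerivAt_quad (a₁ b₁ c₁ t : ℝ) :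
    HasDerivAt (fun t => a₁ * t ^ 2 + b₁ * t + c₁) (2 * a₁ * t + b₁) t := by
  have h1 : HasDerivAt (fun t => a₁ * t ^ 2) (a₁ * (2 * t)) t := by
    simpa using (hasDerivAt_pow 2 t).const_mul a₁
  have h2 : HasDerivAt (fun t => b₁ * t) b₁ t := by simpa using (hasDerivAt_id' t).const_mul b₁
  exact ((h1.add h2).add_const c₁).congr_deriv (by ring)

/-- `hasDerivAt_quadRatio`: auxiliary theorem of the lens-6 development «eis» (instances of 28994/4280) — see the module docstring; verbatim from the lens file. -/
private theorem hasDerivAt_quadRatio (a₁ b₁ c₁ a₂ b₂ c₂ t : ℝ) (h : a₂ * t ^ 2 + b₂ * t + c₂ ≠ 0) :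
    HasDerivAt (fun t => (a₁ * t ^ 2 + b₁ * t + c₁) / (a₂ * t ^ 2 + b₂ * t + c₂))
      (((2 * a₁ * t + b₁) * (a₂ * t ^ 2 + b₂ * t + c₂) -
        (a₁ * t ^ 2 + b₁ * t + c₁) * (2 * a₂ * t + b₂)) / (a₂ * t ^ 2 + b₂ * t + c₂) ^ 2) t :=
  (hasDerivAt_quad a₁ b₁ c₁ t).div (hasDerivAt_quad a₂ b₂ c₂ t) h

/-- Injectivity and image of an interval under a map with positive derivative. -/
private theorem injOn_image_of_deriv_pos {κ κd : ℝ → ℝ} {a b : ℝ} (hab : a ≤ b)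
    (hκd : ∀ t ∈ Icc a b, HasDerivAt κ (κd t) t) (hpos : ∀ t ∈ Icc a b, 0 < κd t) :
    InjOn κ (Icc a b) ∧ κ '' Icc a b = Icc (κ a) (κ b) := by
  have hc : ContinuousOn κ (Icc a b) := fun t ht => (hκd t ht).continuousAt.continuousWithinAt
  have hm : StrictMonoOn κ (Icc a b) := strictMonoOn_of_deriv_pos (convex_Icc a b) hc fun t ht => by
    rw [interior_Icc] at ht
    rw [(hκd t (Ioo_subset_Icc_self ht)).deriv]
    exact hpos t (Ioo_subset_Icc_self ht)
  refine ⟨hm.injOn, Subset.antisymm ?_ (intermediate_value_Icc hab hc)⟩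
  rintro _ ⟨t, ht, rfl⟩
  exact ⟨hm.monotoneOn (left_mem_Icc.2 hab) ht ht.1, hm.monotoneOn ht (right_mem_Icc.2 hab) ht.2⟩

/-- Injectivity and image of an interval under a map with negative derivative. -/
private theorem injOn_image_of_deriv_neg {κ κd : ℝ → ℝ} {a b : ℝ} (hab : a ≤ b)
    (hκd : ∀ t ∈ Icc a b, HasDerivAt κ (κd t) t) (hneg : ∀ t ∈ Icc a b, κd t < 0) :
    InjOn κ (Icc a b) ∧ κ '' Icc a b = Icc (κ b) (κ a) := by
  have hc : ContinuousOn κ (Icc a b) := fun t ht => (hκd t ht).continuousAt.continuousWithinAt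
  have hm : StrictAntiOn κ (Icc a b) := strictAntiOn_of_deriv_neg (convex_Icc a b) hc fun t ht => by
    rw [interior_Icc] at ht
    rw [(hκd t (Ioo_subset_Icc_self ht)).deriv]
    exact hneg t (Ioo_subset_Icc_self ht)
  refine ⟨hm.injOn, Subset.antisymm ?_ (intermediate_value_Icc' hab hc)⟩
  rintro _ ⟨t, ht, rfl⟩
  exact ⟨hm.antitoneOn ht (right_mem_Icc.2 hab) ht.2, hm.antitoneOn (left_mem_Icc.2 hab) ht ht.1⟩

/-! ## The logarithmic arguments (trigonometric dictionary: `t ↔ θ = arg(1 + t ζ₃)`) -/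

/-- A logarithmic argument given on `[a,b]` by a quotient of polynomials. -/
def mkArg (a b : ℚ) (v : ℝ → ℝ) (P Q : MvPolynomial (Fin 1) ℚ) (hQ : ∀ y ∈ ivl a b, aeval y Q ≠ 0)
    (hPQ : ∀ y ∈ ivl a b, aeval y P / aeval y Q = v (y 0)) (h1 : ∀ t ∈ Icc (a : ℝ) b, 1 ≤ v t)
    (hc : ContinuousOn v (Icc (a : ℝ) b)) : LogArg a b :=
  ⟨v, (isSemialgebraicFunOn_aeval_div_aeval (isSemialgebraic_ivl a b) P Q hQ).congr hPQ, h1, hc⟩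

/-- `mkArg_v`: auxiliary theorem of the lens-6 development «eis» (instances of 28994/4280) — see the module docstring; verbatim from the lens file. -/
@[simp] private theorem mkArg_v (a b : ℚ) (v : ℝ → ℝ) (P Q hQ hPQ h1 hc) : (mkArg a b v P Q hQ hPQ h1 hc).v = v := rfl

/-- `(2cos θ)² = (2−t)²/q(t)`. -/
def ccF (t : ℝ) : ℝ := (2 - t) ^ 2 / qf t
/-- `(2cos(θ+60°))² = (1+t)²/q(t)`. -/
def cpF (t : ℝ) : ℝ := (1 + t) ^ 2 / qf t
/-- `(2sin θ)² = 3t²/q(t)`. -/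
def ssF (t : ℝ) : ℝ := 3 * t ^ 2 / qf t
/-- `(2cos(θ−30°))² = 3/q(t)`. -/
def tqF (t : ℝ) : ℝ := 3 / qf t
/-- `2cos(2θ−60°) = (1+2t−2t²)/q(t)`. -/
def wF (t : ℝ) : ℝ := (1 + 2 * t - 2 * t ^ 2) / qf t
/-- `(2cos(θ−30°))²/(2cos(2θ−60°)) = 3/(1+2t−2t²)` — the argument of the A-term. -/
def vAF (t : ℝ) : ℝ := 3 / (1 + 2 * t - 2 * t ^ 2)
/-- `(2cos θ)(2cos(60°−θ)) = (2−t)(1+t)/q(t)`. -/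
def wBF (t : ℝ) : ℝ := (2 - t) * (1 + t) / qf t
/-- `3/((2−t)(1+t))` — the argument of the B-term. -/
def vBF (t : ℝ) : ℝ := 3 / ((2 - t) * (1 + t))

/-- `continuous_ccF`: auxiliary theorem of the lens-6 development «eis» (instances of 28994/4280) — see the module docstring; verbatim from the lens file. -/
private theorem continuous_ccF : Continuous ccF := by
  unfold ccF; exact (by fun_prop : Continuous fun t : ℝ => (2 - t) ^ 2).div
    (by unfold qf; fun_prop) fun t => (qf_pos t).ne'
/-- `continuous_cpF`: auxiliary theorem of the lens-6 development «eis» (instances of 28994/4280) — see the module docstring; verbatim from the lens file. -/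
private theorem continuous_cpF : Continuous cpF := by
  unfold cpF; exact (by fun_prop : Continuous fun t : ℝ => (1 + t) ^ 2).div
    (by unfold qf; fun_prop) fun t => (qf_pos t).ne'
/-- `continuous_ssF`: auxiliary theorem of the lens-6 development «eis» (instances of 28994/4280) — see the module docstring; verbatim from the lens file. -/
private theorem continuous_ssF : Continuous ssF := by
  unfold ssF; exact (by fun_prop : Continuous fun t : ℝ => 3 * t ^ 2).div
    (by unfold qf; fun_prop) fun t => (qf_pos t).ne'
/-- `continuous_tqF`: auxiliary theorem of the lens-6 development «eis» (instances of 28994/4280) — see the module docstring; verbatim from the lens file. -/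
private theorem continuous_tqF : Continuous tqF := by
  unfold tqF; exact (by fun_prop : Continuous fun _ : ℝ => (3 : ℝ)).div
    (by unfold qf; fun_prop) fun t => (qf_pos t).ne'
/-- `continuous_wF`: auxiliary theorem of the lens-6 development «eis» (instances of 28994/4280) — see the module docstring; verbatim from the lens file. -/
private theorem continuous_wF : Continuous wF := by
  unfold wF; exact (by fun_prop : Continuous fun t : ℝ => 1 + 2 * t - 2 * t ^ 2).div
    (by unfold qf; fun_prop) fun t => (qf_pos t).ne'
/-- `continuous_wBF`: auxiliary theorem of the lens-6 development «eis» (instances of 28994/4280) — see the module docstring; verbatim from the lens file. -/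
private theorem continuous_wBF : Continuous wBF := by
  unfold wBF; exact (by fun_prop : Continuous fun t : ℝ => (2 - t) * (1 + t)).div
    (by unfold qf; fun_prop) fun t => (qf_pos t).ne'

/-- `one_le_ccF`: auxiliary theorem of the lens-6 development «eis» (instances of 28994/4280) — see the module docstring; verbatim from the lens file. -/
private theorem one_le_ccF {t : ℝ} (ht : t ≤ 1) : 1 ≤ ccF t := by
  unfold ccF; rw [le_div_iff₀ (qf_pos t)]; unfold qf; nlinarith
/-- `one_le_cpF`: auxiliary theorem of the lens-6 development «eis» (instances of 28994/4280) — see the module docstring; verbatim from the lens file. -/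
private theorem one_le_cpF {t : ℝ} (ht : 0 ≤ t) : 1 ≤ cpF t := by
  unfold cpF; rw [le_div_iff₀ (qf_pos t)]; unfold qf; nlinarith
/-- `one_le_ssF`: auxiliary theorem of the lens-6 development «eis» (instances of 28994/4280) — see the module docstring; verbatim from the lens file. -/
private theorem one_le_ssF {t : ℝ} (ht : 1 / 2 ≤ t) : 1 ≤ ssF t := by
  unfold ssF; rw [le_div_iff₀ (qf_pos t)]; unfold qf; nlinarith
/-- `one_le_tqF`: auxiliary theorem of the lens-6 development «eis» (instances of 28994/4280) — see the module docstring; verbatim from the lens file. -/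
private theorem one_le_tqF {t : ℝ} (h1 : -1 ≤ t) (h2 : t ≤ 2) : 1 ≤ tqF t := by
  unfold tqF; rw [le_div_iff₀ (qf_pos t)]; unfold qf; nlinarith
/-- `one_le_wF`: auxiliary theorem of the lens-6 development «eis» (instances of 28994/4280) — see the module docstring; verbatim from the lens file. -/
private theorem one_le_wF {t : ℝ} (h1 : 0 ≤ t) (h2 : t ≤ 1) : 1 ≤ wF t := by
  unfold wF; rw [le_div_iff₀ (qf_pos t)]; unfold qf; nlinarith
/-- `one_le_wBF`: auxiliary theorem of the lens-6 development «eis» (instances of 28994/4280) — see the module docstring; verbatim from the lens file. -/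
private theorem one_le_wBF {t : ℝ} (h1 : 0 ≤ t) (h2 : t ≤ 1) : 1 ≤ wBF t := by
  unfold wBF; rw [le_div_iff₀ (qf_pos t)]; unfold qf; nlinarith
/-- `dA_pos`: auxiliary theorem of the lens-6 development «eis» (instances of 28994/4280) — see the module docstring; verbatim from the lens file. -/
theorem dA_pos {t : ℝ} (h1 : 0 ≤ t) (h2 : t ≤ 1) : 0 < 1 + 2 * t - 2 * t ^ 2 := by nlinarith
/-- `one_le_vAF`: auxiliary theorem of the lens-6 development «eis» (instances of 28994/4280) — see the module docstring; verbatim from the lens file. -/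
private theorem one_le_vAF {t : ℝ} (h1 : 0 ≤ t) (h2 : t ≤ 1) : 1 ≤ vAF t := by
  unfold vAF; rw [le_div_iff₀ (dA_pos h1 h2)]; nlinarith
/-- `dB_pos`: auxiliary theorem of the lens-6 development «eis» (instances of 28994/4280) — see the module docstring; verbatim from the lens file. -/
theorem dB_pos {t : ℝ} (h1 : 0 ≤ t) (h2 : t ≤ 1) : 0 < (2 - t) * (1 + t) := by nlinarith
/-- `one_le_vBF`: auxiliary theorem of the lens-6 development «eis» (instances of 28994/4280) — see the module docstring; verbatim from the lens file. -/
private theorem one_le_vBF {t : ℝ} (h1 : 0 ≤ t) (h2 : t ≤ 1) : 1 ≤ vBF t := by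
  unfold vBF; rw [le_div_iff₀ (dB_pos h1 h2)]; nlinarith

/-- `aeval_q_ne`: auxiliary theorem of the lens-6 development «eis» (instances of 28994/4280) — see the module docstring; verbatim from the lens file. -/
private theorem aeval_q_ne {y : Fin 1 → ℝ} : aeval y (1 - X 0 + X 0 ^ 2 : MvPolynomial (Fin 1) ℚ) ≠ 0 := by
  have := qf_pos (y 0)
  simp only [map_add, map_sub, map_one, map_pow, aeval_X, qf] at this ⊢
  exact this.ne'

section Args
variable (a b : ℚ)

/-- `(2cos θ)²` on `[a,b] ⊆ (−∞,1]`. -/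
def cc (hb : (b : ℝ) ≤ 1) : LogArg a b :=
  mkArg a b ccF ((2 - X 0) ^ 2) (1 - X 0 + X 0 ^ 2) (fun y _ => aeval_q_ne) (fun y _ => by simp [ccF, qf])
    (fun t ht => one_le_ccF (ht.2.trans hb)) continuous_ccF.continuousOn
/-- `(2cos(θ+60°))²` on `[a,b] ⊆ [0,∞)`. -/
def cp (ha : (0 : ℝ) ≤ a) : LogArg a b :=
  mkArg a b cpF ((1 + X 0) ^ 2) (1 - X 0 + X 0 ^ 2) (fun y _ => aeval_q_ne) (fun y _ => by simp [cpF, qf])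
    (fun t ht => one_le_cpF (ha.trans ht.1)) continuous_cpF.continuousOn
/-- `(2sin θ)²` on `[a,b] ⊆ [1/2,∞)`. -/
def ss (ha : (1 / 2 : ℝ) ≤ a) : LogArg a b :=
  mkArg a b ssF (3 * X 0 ^ 2) (1 - X 0 + X 0 ^ 2) (fun y _ => aeval_q_ne) (fun y _ => by simp [ssF, qf])
    (fun t ht => one_le_ssF (ha.trans ht.1)) continuous_ssF.continuousOn
/-- `(2cos(θ−30°))²` on `[a,b] ⊆ [−1,2]`. -/
def tq (ha : (-1 : ℝ) ≤ a) (hb : (b : ℝ) ≤ 2) : LogArg a b :=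
  mkArg a b tqF 3 (1 - X 0 + X 0 ^ 2) (fun y _ => aeval_q_ne) (fun y _ => by simp [tqF, qf])
    (fun t ht => one_le_tqF (ha.trans ht.1) (ht.2.trans hb)) continuous_tqF.continuousOn
/-- `2cos(2θ−60°)` on `[a,b] ⊆ [0,1]`. -/
def w (ha : (0 : ℝ) ≤ a) (hb : (b : ℝ) ≤ 1) : LogArg a b :=
  mkArg a b wF (1 + 2 * X 0 - 2 * X 0 ^ 2) (1 - X 0 + X 0 ^ 2) (fun y _ => aeval_q_ne)
    (fun y _ => by simp [wF, qf]) (fun t ht => one_le_wF (ha.trans ht.1) (ht.2.trans hb))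
    continuous_wF.continuousOn
/-- `(2cos θ)(2cos(60°−θ))` on `[a,b] ⊆ [0,1]`. -/
def wB (ha : (0 : ℝ) ≤ a) (hb : (b : ℝ) ≤ 1) : LogArg a b :=
  mkArg a b wBF ((2 - X 0) * (1 + X 0)) (1 - X 0 + X 0 ^ 2) (fun y _ => aeval_q_ne)
    (fun y _ => by simp [wBF, qf]) (fun t ht => one_le_wBF (ha.trans ht.1) (ht.2.trans hb))
    continuous_wBF.continuousOn
/-- The argument `3/(1+2t−2t²)` of the A-term on `[a,b] ⊆ [0,1]`. -/
def vA (ha : (0 : ℝ) ≤ a) (hb : (b : ℝ) ≤ 1) : LogArg a b :=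
  mkArg a b vAF 3 (1 + 2 * X 0 - 2 * X 0 ^ 2)
    (fun y hy => by
      have := dA_pos (ha.trans hy.1) (hy.2.trans hb)
      simp only [map_add, map_sub, map_mul, map_one, map_pow, map_ofNat, aeval_X] at this ⊢
      exact this.ne')
    (fun y _ => by simp [vAF]) (fun t ht => one_le_vAF (ha.trans ht.1) (ht.2.trans hb))
    ((by fun_prop : Continuous fun _ : ℝ => (3 : ℝ)).continuousOn.div
      (by fun_prop : Continuous fun t : ℝ => 1 + 2 * t - 2 * t ^ 2).continuousOn
      fun t ht => (dA_pos (ha.trans ht.1) (ht.2.trans hb)).ne')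
/-- The argument `3/((2−t)(1+t))` of the B-term on `[a,b] ⊆ [0,1]`. -/
def vB (ha : (0 : ℝ) ≤ a) (hb : (b : ℝ) ≤ 1) : LogArg a b :=
  mkArg a b vBF 3 ((2 - X 0) * (1 + X 0))
    (fun y hy => by
      have := dB_pos (ha.trans hy.1) (hy.2.trans hb)
      simp only [map_add, map_sub, map_mul, map_one, map_ofNat, aeval_X] at this ⊢
      exact this.ne')
    (fun y _ => by simp [vBF]) (fun t ht => one_le_vBF (ha.trans ht.1) (ht.2.trans hb))
    ((by fun_prop : Continuous fun _ : ℝ => (3 : ℝ)).continuousOn.div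
      (by fun_prop : Continuous fun t : ℝ => (2 - t) * (1 + t)).continuousOn
      fun t ht => (dB_pos (ha.trans ht.1) (ht.2.trans hb)).ne')

/-- `aeval_q2_ne`: auxiliary theorem of the lens-6 development «eis» (instances of 28994/4280) — see the module docstring; verbatim from the lens file. -/
private theorem aeval_q2_ne {y : Fin 1 → ℝ} : aeval y ((1 - X 0 + X 0 ^ 2) ^ 2 : MvPolynomial (Fin 1) ℚ) ≠ 0 := by
  rw [map_pow]; exact pow_ne_zero _ aeval_q_ne

/-- `(2cos(2θ−60°))²` on `[a,b] ⊆ [0,1]`. -/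
def wsq (ha : (0 : ℝ) ≤ a) (hb : (b : ℝ) ≤ 1) : LogArg a b :=
  mkArg a b (fun t => (1 + 2 * t - 2 * t ^ 2) ^ 2 / qf t ^ 2) ((1 + 2 * X 0 - 2 * X 0 ^ 2) ^ 2)
    ((1 - X 0 + X 0 ^ 2) ^ 2) (fun y _ => aeval_q2_ne) (fun y _ => by simp [qf])
    (fun t ht => by
      rw [← div_pow]
      exact one_le_pow₀ (one_le_wF (ha.trans ht.1) (ht.2.trans hb)))
    ((continuous_wF.pow 2).continuousOn.congr fun t _ => by simp [wF, div_pow])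
/-- `((2cos θ)(2cos(60°−θ)))²` on `[a,b] ⊆ [0,1]`. -/
def wBsq (ha : (0 : ℝ) ≤ a) (hb : (b : ℝ) ≤ 1) : LogArg a b :=
  mkArg a b (fun t => ((2 - t) * (1 + t)) ^ 2 / qf t ^ 2) (((2 - X 0) * (1 + X 0)) ^ 2)
    ((1 - X 0 + X 0 ^ 2) ^ 2) (fun y _ => aeval_q2_ne) (fun y _ => by simp [qf])
    (fun t ht => by
      rw [← div_pow]
      exact one_le_pow₀ (one_le_wBF (ha.trans ht.1) (ht.2.trans hb)))
    ((continuous_wBF.pow 2).continuousOn.congr fun t _ => by simp [wBF, div_pow])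
/-- `(2sin 2θ)² = (2sin θ)²(2cos θ)²` on `[a,b] ⊆ [1/2,1]`. -/
def sscc (ha : (1 / 2 : ℝ) ≤ a) (hb : (b : ℝ) ≤ 1) : LogArg a b :=
  mkArg a b (fun t => (3 * t ^ 2 * (2 - t) ^ 2) / (qf t * qf t)) ((3 * X 0 ^ 2) * (2 - X 0) ^ 2)
    ((1 - X 0 + X 0 ^ 2) * (1 - X 0 + X 0 ^ 2)) (fun y _ => by rw [map_mul]; exact mul_ne_zero aeval_q_ne aeval_q_ne)
    (fun y _ => by simp [qf])
    (fun t ht => by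
      rw [← div_mul_div_comm]
      exact one_le_mul_of_one_le_of_one_le (one_le_ssF (ha.trans ht.1)) (one_le_ccF (ht.2.trans hb)))
    ((continuous_ssF.mul continuous_ccF).continuousOn.congr fun t _ =>
      show 3 * t ^ 2 * (2 - t) ^ 2 / (qf t * qf t) = ssF t * ccF t by
        unfold ssF ccF; rw [div_mul_div_comm])

end Args

/-! ## The seven substitutions -/

section Subst
variable (c : ℚ)

/-- `half_le_one`: auxiliary theorem of the lens-6 development «eis» (instances of 28994/4280) — see the module docstring; verbatim from the lens file. -/
private theorem half_le_one : ((1/2 : ℚ) : ℝ) ≤ 1 := by norm_num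
/-- `zero_le_half`: auxiliary theorem of the lens-6 development «eis» (instances of 28994/4280) — see the module docstring; verbatim from the lens file. -/
private theorem zero_le_half : (0 : ℝ) ≤ ((1/2 : ℚ) : ℝ) := by norm_num
/-- `half_le_half`: auxiliary theorem of the lens-6 development «eis» (instances of 28994/4280) — see the module docstring; verbatim from the lens file. -/
private theorem half_le_half : (1 / 2 : ℝ) ≤ ((1/2 : ℚ) : ℝ) := by norm_num
/-- `zle`: auxiliary theorem of the lens-6 development «eis» (instances of 28994/4280) — see the module docstring; verbatim from the lens file. -/
private theorem zle : (0 : ℝ) ≤ ((0 : ℚ) : ℝ) := by norm_num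
/-- `ole`: auxiliary theorem of the lens-6 development «eis» (instances of 28994/4280) — see the module docstring; verbatim from the lens file. -/
private theorem ole : ((1 : ℚ) : ℝ) ≤ 1 := by norm_num
/-- `mole`: auxiliary theorem of the lens-6 development «eis» (instances of 28994/4280) — see the module docstring; verbatim from the lens file. -/
private theorem mole : (-1 : ℝ) ≤ ((-1 : ℚ) : ℝ) := by norm_num
/-- `mole0`: auxiliary theorem of the lens-6 development «eis» (instances of 28994/4280) — see the module docstring; verbatim from the lens file. -/
private theorem mole0 : (-1 : ℝ) ≤ ((0 : ℚ) : ℝ) := by norm_num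
/-- `ole2`: auxiliary theorem of the lens-6 development «eis» (instances of 28994/4280) — see the module docstring; verbatim from the lens file. -/
private theorem ole2 : ((1 : ℚ) : ℝ) ≤ 2 := by norm_num
/-- `hle1`: auxiliary theorem of the lens-6 development «eis» (instances of 28994/4280) — see the module docstring; verbatim from the lens file. -/
private theorem hle1 : ((1/2 : ℚ) : ℝ) ≤ 1 := by norm_num
/-- `zle1`: auxiliary theorem of the lens-6 development «eis» (instances of 28994/4280) — see the module docstring; verbatim from the lens file. -/
private theorem zle1 : ((0 : ℚ) : ℝ) ≤ 1 := by norm_num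

/-- `w` on `[0,½]`, `[½,1]`, `[0,1]`; `cc` on the various intervals; etc. -/
def w01 : LogArg 0 1 := w 0 1 zle ole
/-- `w0h`: auxiliary def of the lens-6 development «eis» (instances of 28994/4280) — see the module docstring; verbatim from the lens file. -/
def w0h : LogArg 0 (1/2) := w 0 (1/2) zle hle1
/-- `wh1`: auxiliary def of the lens-6 development «eis» (instances of 28994/4280) — see the module docstring; verbatim from the lens file. -/
def wh1 : LogArg (1/2) 1 := w (1/2) 1 zero_le_half ole
/-- `wsqh1`: auxiliary def of the lens-6 development «eis» (instances of 28994/4280) — see the module docstring; verbatim from the lens file. -/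
def wsqh1 : LogArg (1/2) 1 := wsq (1/2) 1 zero_le_half ole
/-- `cc01`: auxiliary def of the lens-6 development «eis» (instances of 28994/4280) — see the module docstring; verbatim from the lens file. -/
def cc01 : LogArg 0 1 := cc 0 1 ole
/-- `cc0h`: auxiliary def of the lens-6 development «eis» (instances of 28994/4280) — see the module docstring; verbatim from the lens file. -/
def cc0h : LogArg 0 (1/2) := cc 0 (1/2) hle1
/-- `cch1`: auxiliary def of the lens-6 development «eis» (instances of 28994/4280) — see the module docstring; verbatim from the lens file. -/
def cch1 : LogArg (1/2) 1 := cc (1/2) 1 ole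
/-- `ccm1h`: auxiliary def of the lens-6 development «eis» (instances of 28994/4280) — see the module docstring; verbatim from the lens file. -/
def ccm1h : LogArg (-1) (1/2) := cc (-1) (1/2) hle1
/-- `ccm10`: auxiliary def of the lens-6 development «eis» (instances of 28994/4280) — see the module docstring; verbatim from the lens file. -/
def ccm10 : LogArg (-1) 0 := cc (-1) 0 zle1
/-- `cp01`: auxiliary def of the lens-6 development «eis» (instances of 28994/4280) — see the module docstring; verbatim from the lens file. -/
def cp01 : LogArg 0 1 := cp 0 1 zle
/-- `ssh1`: auxiliary def of the lens-6 development «eis» (instances of 28994/4280) — see the module docstring; verbatim from the lens file. -/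
def ssh1 : LogArg (1/2) 1 := ss (1/2) 1 half_le_half
/-- `sscch1`: auxiliary def of the lens-6 development «eis» (instances of 28994/4280) — see the module docstring; verbatim from the lens file. -/
def sscch1 : LogArg (1/2) 1 := sscc (1/2) 1 half_le_half ole
/-- `tq01`: auxiliary def of the lens-6 development «eis» (instances of 28994/4280) — see the module docstring; verbatim from the lens file. -/
def tq01 : LogArg 0 1 := tq 0 1 mole0 ole2
/-- `vA01`: auxiliary def of the lens-6 development «eis» (instances of 28994/4280) — see the module docstring; verbatim from the lens file. -/
def vA01 : LogArg 0 1 := vA 0 1 zle ole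
/-- `vB01`: auxiliary def of the lens-6 development «eis» (instances of 28994/4280) — see the module docstring; verbatim from the lens file. -/
def vB01 : LogArg 0 1 := vB 0 1 zle ole
/-- `wB01`: auxiliary def of the lens-6 development «eis» (instances of 28994/4280) — see the module docstring; verbatim from the lens file. -/
def wB01 : LogArg 0 1 := wB 0 1 zle ole
/-- `wBsq01`: auxiliary def of the lens-6 development «eis» (instances of 28994/4280) — see the module docstring; verbatim from the lens file. -/
def wBsq01 : LogArg 0 1 := wBsq 0 1 zle ole

/-- Reflection `θ ↦ 60° − θ` (`t ↦ 1 − t`): `U_c([0,½], w) ≡ U_c([½,1], w)`. -/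
theorem subst_R2 : KZ.of (U 0 (1/2) c w0h) - KZ.of (U (1/2) 1 c wh1) ∈ KZ.relations := by
  have hd : ∀ t ∈ Icc ((0 : ℚ) : ℝ) ((1/2 : ℚ) : ℝ), HasDerivAt (fun t : ℝ => 1 - t) (-1 : ℝ) t :=
    fun t _ => by simpa using (hasDerivAt_id' t).const_sub 1
  obtain ⟨hinj, himg⟩ := injOn_image_of_deriv_neg (κd := fun _ => (-1 : ℝ)) (by norm_num) hd
    (fun _ _ => by norm_num)
  refine rel_subst _ _ (fun t => 1 - t) (fun _ => -1) (1 - X 0) 1 (fun y _ => by simp)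
    (fun y _ => by simp) hd hinj (by rw [himg]; norm_num) (fun t ht => ?_) (fun t ht => ?_)
  · show wF t = wF (1 - t)
    unfold wF qf; ring
  · simp only [abs_neg, abs_one, mul_one]
    unfold qf; ring

end Subst

end Summit.KontsevichZagierPeriods.RootDecompQuadraticDescent.EisensteinPair

end
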